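import Mathlib
import HarnessLib
import Literature.NumberTheory.LFunctions.ZetaScrew
import Summits.RiemannHypothesis.RiemannHypothesis.Theorems.IntegerScrewPivotUpperBound

/-!
# Route `IntegerScrew` — the `K`-NODE TRIAL INEQUALITY for the pivot, in increment form
# (PIVOT-LAW §15.3; the algebraic half of the continuum floor; RH-FREE given `S_{M−1} ≻ 0`)

`d_M` is the squared distance of the newest node `x_{log M}` of Kreĭn's screw line from the span of the
earlier nodes (`IntegerScrewPivotUpperBound.screwPivot_add_two_le_form`: `d_M ≤ Q(y, 1)` for every
coefficient vector `y`, whenever `S_{M−1} ≻ 0`).  This file evaluates that bound at the predictors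
built from the last `K + 1` INCREMENTS `I_{M−k} = x_{log(M−k)} − x_{log(M−k−1)}`, `0 ≤ k ≤ K`:

* `screwPivot_add_two_le_natForm` — the bound as the full form `Σ_{m,m' ∈ [2,M]} G(log m, log m') x_m x_{m'}`
  over node labels (`x_M = 1`);
* `sum_kernel_eq_neg_sum_of_sum_eq_zero` — for zero-sum coefficients the one-point terms of
  `G(t,u) = Ψ(t) + Ψ(u) − Ψ(t−u)` cancel: the form is `−Σ Ψ(log m − log m') x_m x_{m'}` (stationary
  increments);
* `sum_range_diff_mul`, `sum_sum_range_diff_mul` — Abel summation in one and two indices;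
* **`screwPivot_le_incrementForm`** — for `M ≥ K + 3`, `S_{M−1} ≻ 0` and increment coefficients
  `t_k = σ(k+1)` with `t_0 = 1`, `t_{K+1} = 0`:
  `d_M ≤ Σ_{j,k ≤ K} t_j t_k·[Ψ(ℓ_j − ℓ_{k+1}) + Ψ(ℓ_{j+1} − ℓ_k) − Ψ(ℓ_j − ℓ_k) − Ψ(ℓ_{j+1} − ℓ_{k+1})]`,
  `ℓ_a = log(M − a)` — the Gram matrix of the increments (diagonal `2Ψ(h_{M−k})`, first row the lag-`k`
  covariances of `IntegerScrewIncrementCovLag`).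

The analytic half (the limits of the brackets and the choice `t_k = −(c_k/2)/log M`, giving
`G(M)·log M ≥ S_K − o(1)`) is `IntegerScrewKNodeFloor`.  Pure linear algebra over the explicit matrix
`screwMatrix`; nothing here bears on the truth of RH. [Suzuki2023, (1.4)]
-/

noncomputable section

-- D-0017: `Summit.<S>.<S>.…` is the designed namespace of a single-problem summit.
set_option linter.dupNamespace false

namespace Summit.RiemannHypothesis.RiemannHypothesis.Theorems.IntegerScrew

open Literature.NumberTheory.LFunctions Finset Matrix

/-- The pivot below the FULL quadratic form in node labels: for `S_{n+1} = screwMatrix n ≻ 0` and any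
coefficient sequence `x : ℕ → ℝ` with `x (n+2) = 1`,
`d_{n+2} ≤ Σ_{m,m' ∈ [2, n+2]} G(log m, log m')·x_m x_{m'}` (the form of `S_{n+2}` at `(x_2,…,x_{n+2})`;
`IntegerScrewPivotUpperBound.screwPivot_add_two_le_form` re-packaged). [folklore] -/
theorem screwPivot_add_two_le_natForm (n : ℕ) (hn : (screwMatrix n).PosDef) (x : ℕ → ℝ)
    (hx : x (n + 2) = 1) :
    screwPivot (n + 2) ≤ ∑ m ∈ Icc 2 (n + 2), ∑ m' ∈ Icc 2 (n + 2),
      zetaScrewKernel (Real.log m) (Real.log m') * (x m * x m') := by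
  set v : Fin n → ℝ := fun i => x ((i : ℕ) + 2) with hv
  have h := screwPivot_add_two_le_form n hn v
  have hform : v ⬝ᵥ screwMatrix n *ᵥ v = ∑ m ∈ Icc 2 (n + 1), ∑ m' ∈ Icc 2 (n + 1),
      zetaScrewKernel (Real.log m) (Real.log m') * (x m * x m') := by
    have := screwMatrix_form_eq_Icc n v x (fun i => rfl)
    rwa [star_trivial] at this
  have hborder : (fun i => screwBorder n i 0) ⬝ᵥ v
      = ∑ m ∈ Icc 2 (n + 1), zetaScrewKernel (Real.log m) (Real.log ((n + 2 : ℕ) : ℝ)) * x m := by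
    rw [sum_Icc_two_eq_sum_fin (fun m => zetaScrewKernel (Real.log m) (Real.log ((n + 2 : ℕ) : ℝ)) * x m) n]
    simp only [dotProduct, screwBorder, Matrix.of_apply, hv]
  -- split the target sum at the top index `n + 2`
  rw [Finset.sum_Icc_succ_top (by omega : 2 ≤ n + 1 + 1)]
  simp_rw [Finset.sum_Icc_succ_top (show 2 ≤ n + 1 + 1 by omega)]
  rw [Finset.sum_add_distrib]
  -- identify the pieces
  have hsymm : ∀ m : ℕ, zetaScrewKernel (Real.log ((n + 1 + 1 : ℕ) : ℝ)) (Real.log m)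
      = zetaScrewKernel (Real.log m) (Real.log ((n + 1 + 1 : ℕ) : ℝ)) := fun m => zetaScrewKernel_comm _ _
  have e12 : (n + 1 + 1 : ℕ) = n + 2 := by ring
  rw [e12] at *
  rw [hx]
  have hcorner : zetaScrewKernel (Real.log ((n + 2 : ℕ) : ℝ)) (Real.log ((n + 2 : ℕ) : ℝ))
      = 2 * zetaScrew (Real.log ((n + 2 : ℕ) : ℝ)) := zetaScrewKernel_self _
  calc screwPivot (n + 2)
      ≤ 2 * zetaScrew (Real.log ((n + 2 : ℕ) : ℝ)) + v ⬝ᵥ screwMatrix n *ᵥ v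
          + 2 * ((fun i => screwBorder n i 0) ⬝ᵥ v) := h
    _ = (∑ m ∈ Icc 2 (n + 1), ∑ m' ∈ Icc 2 (n + 1),
            zetaScrewKernel (Real.log m) (Real.log m') * (x m * x m')
          + ∑ m ∈ Icc 2 (n + 1), zetaScrewKernel (Real.log m) (Real.log ((n + 2 : ℕ) : ℝ)) * (x m * 1))
        + (∑ m' ∈ Icc 2 (n + 1), zetaScrewKernel (Real.log ((n + 2 : ℕ) : ℝ)) (Real.log m') * (1 * x m')
          + zetaScrewKernel (Real.log ((n + 2 : ℕ) : ℝ)) (Real.log ((n + 2 : ℕ) : ℝ)) * (1 * 1)) := by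
        rw [hform, hborder, hcorner]
        simp only [mul_one, one_mul, hsymm]
        ring

/-- CANCELLATION of the one-point terms: if the coefficients sum to zero over `s`, the form of the
kernel `G(t,u) = Ψ(t) + Ψ(u) − Ψ(t − u)` reduces to `−Σ Ψ(log m − log m')·x_m x_{m'}` (the screw line
has stationary increments; a zero-sum configuration does not see the origin). [folklore] -/
theorem sum_kernel_eq_neg_sum_of_sum_eq_zero (s : Finset ℕ) (x : ℕ → ℝ) (hs : ∑ m ∈ s, x m = 0) :
    ∑ m ∈ s, ∑ m' ∈ s, zetaScrewKernel (Real.log m) (Real.log m') * (x m * x m')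
      = -∑ m ∈ s, ∑ m' ∈ s, zetaScrew (Real.log m - Real.log m') * (x m * x m') := by
  have h1 : ∑ m ∈ s, ∑ m' ∈ s, zetaScrew (Real.log m) * (x m * x m') = 0 := by
    have : ∀ m ∈ s, ∑ m' ∈ s, zetaScrew (Real.log m) * (x m * x m')
        = zetaScrew (Real.log m) * x m * ∑ m' ∈ s, x m' := by
      intro m _
      rw [Finset.mul_sum]
      exact Finset.sum_congr rfl fun m' _ => by ring
    rw [Finset.sum_congr rfl this]
    simp [hs]
  have h2 : ∑ m ∈ s, ∑ m' ∈ s, zetaScrew (Real.log m') * (x m * x m') = 0 := by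
    rw [Finset.sum_comm]
    have : ∀ m' ∈ s, ∑ m ∈ s, zetaScrew (Real.log m') * (x m * x m')
        = zetaScrew (Real.log m') * x m' * ∑ m ∈ s, x m := by
      intro m' _
      rw [Finset.mul_sum]
      exact Finset.sum_congr rfl fun m _ => by ring
    rw [Finset.sum_congr rfl this]
    simp [hs]
  have hsplit : ∀ m ∈ s, ∑ m' ∈ s, zetaScrewKernel (Real.log m) (Real.log m') * (x m * x m')
      = ∑ m' ∈ s, zetaScrew (Real.log m) * (x m * x m')
        + ∑ m' ∈ s, zetaScrew (Real.log m') * (x m * x m')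
        - ∑ m' ∈ s, zetaScrew (Real.log m - Real.log m') * (x m * x m') := by
    intro m _
    rw [← Finset.sum_add_distrib, ← Finset.sum_sub_distrib]
    exact Finset.sum_congr rfl fun m' _ => by rw [zetaScrewKernel]; ring
  rw [Finset.sum_congr rfl hsplit, Finset.sum_sub_distrib, Finset.sum_add_distrib, h1, h2]
  ring

/-- SUPPORT RESTRICTION: a double sum over `Icc 2 N` of terms vanishing off `Icc L N` (`2 ≤ L`) is
the double sum over `Icc L N`. [folklore] -/
theorem sum_sum_Icc_eq_of_support {N L : ℕ} (hL : 2 ≤ L) (f : ℕ → ℕ → ℝ) (x : ℕ → ℝ)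
    (hx : ∀ m, m < L → x m = 0) :
    ∑ m ∈ Icc 2 N, ∑ m' ∈ Icc 2 N, f m m' * (x m * x m')
      = ∑ m ∈ Icc L N, ∑ m' ∈ Icc L N, f m m' * (x m * x m') := by
  have hsub : Icc L N ⊆ Icc 2 N := Finset.Icc_subset_Icc_left hL
  have hzero : ∀ m ∈ Icc 2 N, m ∉ Icc L N → x m = 0 := by
    intro m hm hm'
    rw [Finset.mem_Icc] at hm hm'
    exact hx m (by omega)
  symm
  rw [Finset.sum_subset hsub (fun m hm hm' => by
    rw [hzero m hm hm']; simp)]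
  exact Finset.sum_congr rfl fun m _ => Finset.sum_subset hsub fun m' hm hm' => by
    rw [hzero m' hm hm']; simp

/-- RE-INDEXING by the offset from the corner: `Σ_{m ∈ [M−K−1, M]} g(m) = Σ_{a < K+2} g(M − a)` for
`K + 1 ≤ M`. [folklore] -/
theorem sum_Icc_eq_sum_range_offset {M K : ℕ} (hK : K + 1 ≤ M) (g : ℕ → ℝ) :
    ∑ m ∈ Icc (M - K - 1) M, g m = ∑ a ∈ range (K + 2), g (M - a) := by
  have hIcc : Icc (M - K - 1) M = Ico (M - K - 1) (M + 1) := by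
    ext m; simp only [Finset.mem_Icc, Finset.mem_Ico]; omega
  rw [hIcc, Finset.sum_Ico_eq_sum_range]
  have hlen : M + 1 - (M - K - 1) = K + 2 := by omega
  rw [hlen, ← Finset.sum_range_reflect]
  refine Finset.sum_congr rfl fun a ha => ?_
  rw [Finset.mem_range] at ha
  congr 1
  omega

/-- ABEL SUMMATION (one index): with `ξ_a = σ(a+1) − σ(a)` and `σ(0) = 0`, `σ(K+2) = 0`,
`Σ_{a<K+2} ξ_a f(a) = Σ_{j<K+1} σ(j+1)·(f(j) − f(j+1))`. [folklore] -/
theorem sum_range_diff_mul (K : ℕ) (σ : ℕ → ℝ) (hσ0 : σ 0 = 0) (hσK : σ (K + 2) = 0) (f : ℕ → ℝ) :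
    ∑ a ∈ range (K + 2), (σ (a + 1) - σ a) * f a
      = ∑ j ∈ range (K + 1), σ (j + 1) * (f j - f (j + 1)) := by
  have h1 : ∑ a ∈ range (K + 2), (σ (a + 1) - σ a) * f a
      = ∑ a ∈ range (K + 2), σ (a + 1) * f a - ∑ a ∈ range (K + 2), σ a * f a := by
    rw [← Finset.sum_sub_distrib]; exact Finset.sum_congr rfl fun a _ => by ring
  rw [h1, Finset.sum_range_succ (fun a => σ (a + 1) * f a) (K + 1), hσK, zero_mul, add_zero,
    Finset.sum_range_succ' (fun a => σ a * f a) (K + 1), hσ0, zero_mul, add_zero,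
    ← Finset.sum_sub_distrib]
  exact Finset.sum_congr rfl fun j _ => by ring

/-- ABEL SUMMATION (both indices): for any kernel `Φ`,
`Σ_{a,b<K+2} Φ(a,b) ξ_a ξ_b = Σ_{j,k<K+1} σ(j+1)σ(k+1)·(Φ(j,k) − Φ(j,k+1) − Φ(j+1,k) + Φ(j+1,k+1))`
(`ξ = Δσ` as above). [folklore] -/
theorem sum_sum_range_diff_mul (K : ℕ) (σ : ℕ → ℝ) (hσ0 : σ 0 = 0) (hσK : σ (K + 2) = 0)
    (Φ : ℕ → ℕ → ℝ) :
    ∑ a ∈ range (K + 2), ∑ b ∈ range (K + 2), Φ a b * ((σ (a + 1) - σ a) * (σ (b + 1) - σ b))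
      = ∑ j ∈ range (K + 1), ∑ k ∈ range (K + 1),
          σ (j + 1) * σ (k + 1) * (Φ j k - Φ j (k + 1) - Φ (j + 1) k + Φ (j + 1) (k + 1)) := by
  -- inner Abel in `b`, for each fixed `a`
  have hinner : ∀ a : ℕ, ∑ b ∈ range (K + 2), Φ a b * ((σ (a + 1) - σ a) * (σ (b + 1) - σ b))
      = (σ (a + 1) - σ a) * ∑ k ∈ range (K + 1), σ (k + 1) * (Φ a k - Φ a (k + 1)) := by
    intro a
    rw [← sum_range_diff_mul K σ hσ0 hσK (Φ a), Finset.mul_sum]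
    exact Finset.sum_congr rfl fun b _ => by ring
  simp_rw [hinner]
  -- outer Abel in `a`
  rw [sum_range_diff_mul K σ hσ0 hσK (fun a => ∑ k ∈ range (K + 1), σ (k + 1) * (Φ a k - Φ a (k + 1)))]
  refine Finset.sum_congr rfl fun j _ => ?_
  rw [← Finset.sum_sub_distrib, Finset.mul_sum]
  exact Finset.sum_congr rfl fun k _ => by ring

/-- **THE `K`-NODE TRIAL INEQUALITY (increment form).** For `M ≥ K + 3` with `S_{M−1} ≻ 0` and
increment coefficients `t_k = σ(k+1)` (`σ(0) = 0`, `t_0 = σ(1) = 1`, `t_{K+1} = σ(K+2) = 0`):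
`d_M ≤ ‖Σ_{k=0}^{K} t_k I_{M−k}‖² = Σ_{j,k ≤ K} t_j t_k·[Ψ(ℓ_j − ℓ_{k+1}) + Ψ(ℓ_{j+1} − ℓ_k) − Ψ(ℓ_j − ℓ_k) − Ψ(ℓ_{j+1} − ℓ_{k+1})]`,
`ℓ_a = log(M − a)` — the Gram matrix of the increments `I_{M−k} = x_{log(M−k)} − x_{log(M−k−1)}` of the
screw line (diagonal `2Ψ(h_{M−k})`, row `0` the lag-`k` covariances of PIVOT-LAW §2a(iv)/§15).
[folklore] -/
theorem screwPivot_le_incrementForm (M K : ℕ) (hM : K + 3 ≤ M) (hPD : (screwMatrix (M - 2)).PosDef)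
    (σ : ℕ → ℝ) (hσ0 : σ 0 = 0) (hσ1 : σ 1 = 1) (hσK : σ (K + 2) = 0) :
    screwPivot M ≤ ∑ j ∈ range (K + 1), ∑ k ∈ range (K + 1), σ (j + 1) * σ (k + 1) *
      (zetaScrew (Real.log ((M : ℝ) - j) - Real.log ((M : ℝ) - (k + 1)))
        + zetaScrew (Real.log ((M : ℝ) - (j + 1)) - Real.log ((M : ℝ) - k))
        - zetaScrew (Real.log ((M : ℝ) - j) - Real.log ((M : ℝ) - k))
        - zetaScrew (Real.log ((M : ℝ) - (j + 1)) - Real.log ((M : ℝ) - (k + 1)))) := by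
  obtain ⟨n, rfl⟩ : ∃ n, M = n + 2 := ⟨M - 2, by omega⟩
  have hn2 : n + 2 - 2 = n := by omega
  rw [hn2] at hPD
  -- node coefficients: x_m = σ(M−m+1) − σ(M−m) on [M−K−1, M], zero elsewhere
  set x : ℕ → ℝ := fun m => if m + K + 1 < n + 2 then 0 else σ (n + 2 - m + 1) - σ (n + 2 - m)
    with hxdef
  have hxM : x (n + 2) = 1 := by
    simp only [hxdef, show ¬ (n + 2 + K + 1 < n + 2) by omega, if_false, Nat.sub_self, zero_add,
      hσ1, hσ0, sub_zero]
  have hx0 : ∀ m, m < n + 2 - K - 1 → x m = 0 := by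
    intro m hm
    simp only [hxdef, show m + K + 1 < n + 2 by omega, if_true]
  -- 1. the full form
  have h1 := screwPivot_add_two_le_natForm n hPD x hxM
  -- 2. restrict the support
  rw [sum_sum_Icc_eq_of_support (by omega : 2 ≤ n + 2 - K - 1)
    (fun m m' => zetaScrewKernel (Real.log m) (Real.log m')) x hx0] at h1
  -- 3. the coefficients sum to zero
  have hoff : ∀ a, a < K + 2 → x (n + 2 - a) = σ (a + 1) - σ a := by
    intro a ha
    simp only [hxdef, show ¬ (n + 2 - a + K + 1 < n + 2) by omega, if_false,
      show n + 2 - (n + 2 - a) = a by omega]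
  have hsum : ∑ m ∈ Icc (n + 2 - K - 1) (n + 2), x m = 0 := by
    rw [sum_Icc_eq_sum_range_offset (by omega : K + 1 ≤ n + 2)]
    rw [Finset.sum_congr rfl fun a ha => hoff a (Finset.mem_range.1 ha)]
    rw [Finset.sum_range_sub σ (K + 2), hσK, hσ0, sub_zero]
  rw [sum_kernel_eq_neg_sum_of_sum_eq_zero _ x hsum] at h1
  -- 4. re-index both sums by the offset from the corner
  rw [sum_Icc_eq_sum_range_offset (by omega : K + 1 ≤ n + 2)] at h1
  simp_rw [sum_Icc_eq_sum_range_offset (show K + 1 ≤ n + 2 by omega)] at h1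
  -- rewrite the coefficients and casts on `range (K+2)`
  have hcast : ∀ a, a < K + 2 → (((n + 2 - a : ℕ) : ℝ)) = ((n + 2 : ℕ) : ℝ) - a := by
    intro a ha
    rw [Nat.cast_sub (by omega)]
  have h2 : ∑ a ∈ range (K + 2), ∑ b ∈ range (K + 2),
        zetaScrew (Real.log ((n + 2 - a : ℕ) : ℝ) - Real.log ((n + 2 - b : ℕ) : ℝ))
          * (x (n + 2 - a) * x (n + 2 - b))
      = ∑ a ∈ range (K + 2), ∑ b ∈ range (K + 2),
        zetaScrew (Real.log (((n + 2 : ℕ) : ℝ) - a) - Real.log (((n + 2 : ℕ) : ℝ) - b))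
          * ((σ (a + 1) - σ a) * (σ (b + 1) - σ b)) := by
    refine Finset.sum_congr rfl fun a ha => Finset.sum_congr rfl fun b hb => ?_
    rw [Finset.mem_range] at ha hb
    rw [hcast a ha, hcast b hb, hoff a ha, hoff b hb]
  rw [h2, sum_sum_range_diff_mul K σ hσ0 hσK] at h1
  -- 5. match the target (signs inside the bracket; casts of `j + 1`)
  refine h1.trans (le_of_eq ?_)
  rw [← Finset.sum_neg_distrib]
  refine Finset.sum_congr rfl fun j _ => ?_
  rw [← Finset.sum_neg_distrib]
  refine Finset.sum_congr rfl fun k _ => ?_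
  push_cast
  ring

end Summit.RiemannHypothesis.RiemannHypothesis.Theorems.IntegerScrew
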